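import Mathlib.RingTheory.HopfAlgebra.Convolution
import Mathlib.RingTheory.Norm.Basic
import Mathlib.RingTheory.TensorProduct.Free
import Mathlib.LinearAlgebra.FreeModule.Finite.Basic
import HarnessLib

/-!
# Deligne's theorem: a finite free commutative group scheme is killed by its order

Let `H` be a commutative and cocommutative Hopf algebra over a commutative ring `R` which is
finite free of rank `m` as an `R`-module — i.e. `G = Spec H` is a finite free (in particular
finite locally free) commutative group scheme of order `m` over `Spec R`. For every commutative
`R`-algebra `R'` the `R'`-valued points `G(R') = Hom_{R-alg}(H, R')` form a commutative monoid
(indeed a group) under convolution (Mathlib's `WithConv (H →ₐ[R] R')`). **Deligne's theorem** says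
that every `x ∈ G(R')` satisfies `x ^ m = 1` (Görtz–Wedhorn, *Algebraic Geometry II*, Prop. 27.86
and its proof, §(27.14), PDF pp. 835–836 of the held copy; Tate–Oort, *Group schemes of prime
order*, §1, Theorem (Deligne); Oort–Tate attribute the proof to Deligne).

We formalise the printed proof (Görtz–Wedhorn II, p. 836: `N(id_G) = N(ψ_g^*(id_G)) =
N(id_G) N(φ^*(g)) = N(id_G) g^r`), phrased entirely inside convolution algebras:

* `D = WithConv (H →ₗ[R] R')` (the `R'`-valued "distributions", the base change to `R'` of the
  Cartier dual algebra `H^D`) is a commutative ring, and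
  `E = WithConv (H →ₗ[R] R' ⊗[R] H)` is a commutative `D`-algebra
  (`Literature.NumberTheory.DiophantineGeometry.Deligne.instAlgebra`, via post-composition with `R' → R' ⊗ H`), free of rank `m` over
  `D` (`Literature.NumberTheory.DiophantineGeometry.Deligne.basisE`);
* `I = (h ↦ 1 ⊗ h) ∈ E` is a unit (its inverse is `h ↦ 1 ⊗ S h`);
* for `x ∈ G(R')`, left translation by `x` is an `R'`-algebra automorphism `σ_x` of `R' ⊗ H`
  (`Literature.NumberTheory.DiophantineGeometry.Deligne.transAlgEquiv`), and post-composition with it is a `D`-algebra automorphism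
  `T_x` of `E` with `T_x I = ξ • I`, where `ξ ∈ D` is the linear map underlying `x`;
* taking norms `N_{E/D}`: `N(I) = N(T_x I) = ξ ^ m N(I)`, and `N(I)` is a unit, so `ξ ^ m = 1`,
  i.e. `x ^ m = 1` in `G(R')` (`Literature.NumberTheory.DiophantineGeometry.Deligne.convPow_finrank_eq_one`).

## Main statements

* `Literature.NumberTheory.DiophantineGeometry.Deligne.convPow_finrank_eq_one`: Deligne's theorem, `x ^ finrank R H = 1` for
  `x : WithConv (H →ₐ[R] R')`.
* `Literature.NumberTheory.DiophantineGeometry.FiniteFlatGroupScheme.killedByOrder`: the same statement as a named `Prop`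
  (Görtz–Wedhorn II, Prop. 27.86), with `killedByOrder_holds`.

## Design notes

* Everything is stated for Mathlib's unbundled `HopfAlgebra R H` with `CommRing H` and
  `Coalgebra.IsCocomm R H`; points are Mathlib's convolution monoid `WithConv (H →ₐ[R] R')`
  (`Mathlib.RingTheory.Bialgebra.Convolution`). Mathlib's *group* instance
  `AlgHom.convGroup` needlessly assumes a bialgebra structure on the target, so we do not use
  it; the inverse `x⁻¹ = x ∘ S` and `x⁻¹ * x = 1` are re-derived here (`Literature.NumberTheory.DiophantineGeometry.Deligne.convInv`).
* The `D`-algebra structure on `E` is a `def` used as a local instance only.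
* Mathlib searched: `LinearMap.algHom_comp_convMul_distrib`, `AlgHom.comp_convMul_distrib`,
  `AlgHom.toLinearMap_convMul`, `LinearMap.id_mul_antipode`, `Algebra.norm_eq_of_algEquiv`,
  `Algebra.norm_algebraMap_of_basis`, `Algebra.TensorProduct.basis`, `Coalgebra.Repr` (all
  used); Mathlib has no finite group schemes, Cartier duality or Deligne's theorem.

## References

* U. Görtz, T. Wedhorn, *Algebraic Geometry II* (2023), Prop. 27.86 and its proof.
* J. Tate, F. Oort, *Group schemes of prime order*, Ann. Sci. ÉNS 3 (1970), §1.
-/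

universe u v w

open TensorProduct WithConv Coalgebra HopfAlgebra

noncomputable section

namespace Literature.NumberTheory.DiophantineGeometry

namespace Deligne

variable {R : Type u} [CommRing R] {H : Type v} [CommRing H] [HopfAlgebra R H]

/-! ### Post-composition with an algebra homomorphism -/

section PostComp

variable {A : Type*} [Semiring A] [Algebra R A] {B : Type*} [Semiring B] [Algebra R B]
  {C : Type*} [Semiring C] [Algebra R C]

/-- Post-composition with an algebra homomorphism `h : A → B` is a ring homomorphism of
convolution algebras `Hom_R(H, A) → Hom_R(H, B)` (Mathlib
`LinearMap.algHom_comp_convMul_distrib`). [folklore] -/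
def postComp (h : A →ₐ[R] B) : WithConv (H →ₗ[R] A) →+* WithConv (H →ₗ[R] B) where
  toFun F := toConv (h.toLinearMap ∘ₗ F.ofConv)
  map_one' := by
    ext c
    simp [LinearMap.convOne_def]
  map_mul' F G := congrArg toConv (LinearMap.algHom_comp_convMul_distrib h F G)
  map_zero' := by ext; simp
  map_add' F G := by ext; simp

/-- `postComp h F c = h (F c)`. [folklore] -/
@[simp]
theorem postComp_apply (h : A →ₐ[R] B) (F : WithConv (H →ₗ[R] A)) (c : H) :
    postComp h F c = h (F c) := rfl

/-- `postComp` is functorial. [folklore] -/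
theorem postComp_comp (g : B →ₐ[R] C) (h : A →ₐ[R] B) (F : WithConv (H →ₗ[R] A)) :
    postComp (g.comp h) F = postComp g (postComp h F) := rfl

/-- `postComp` of the identity. [folklore] -/
@[simp]
theorem postComp_id (F : WithConv (H →ₗ[R] A)) : postComp (AlgHom.id R A) F = F := rfl

/-- `postComp h` on the linear map underlying an algebra homomorphism `x`. [folklore] -/
theorem postComp_toConv_toLinearMap (h : A →ₐ[R] B) (x : H →ₐ[R] A) :
    postComp h (toConv x.toLinearMap) = toConv (h.comp x).toLinearMap := rfl

end PostComp

/-! ### Points: inverses in the convolution monoid `Hom_{R-alg}(H, R')` -/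

section Points

variable {R' : Type w} [CommRing R'] [Algebra R R']

/-- The inverse `x⁻¹ = x ∘ S` of an `R'`-valued point of `Spec H` (Mathlib `AlgHom.convInv`,
without its superfluous bialgebra hypothesis on `R'`). [folklore] -/
def convInv (x : WithConv (H →ₐ[R] R')) : WithConv (H →ₐ[R] R') :=
  toConv (x.ofConv.comp (HopfAlgebra.antipodeAlgHom R H))

/-- `x⁻¹ * x = 1` for points of a commutative Hopf algebra (Mathlib `AlgHom.convGroup`). [folklore] -/
theorem convInv_mul (x : WithConv (H →ₐ[R] R')) : convInv x * x = 1 := by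
  apply WithConv.ofConv_injective
  apply AlgHom.toLinearMap_injective
  apply WithConv.toConv_injective
  rw [AlgHom.toLinearMap_convMul, AlgHom.toLinearMap_convOne]
  change postComp x.ofConv (toConv (antipode R (A := H))) * postComp x.ofConv (toConv .id) = 1
  rw [← map_mul, LinearMap.antipode_mul_id, map_one]

/-- `x * x⁻¹ = 1` for points of a commutative cocommutative Hopf algebra. [folklore] -/
theorem mul_convInv [Coalgebra.IsCocomm R H] (x : WithConv (H →ₐ[R] R')) : x * convInv x = 1 := by
  rw [mul_comm, convInv_mul]

end Points

/-! ### The algebras `D = Hom_R(H, R')` and `E = Hom_R(H, R' ⊗ H)` -/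

section Algebras

variable [Coalgebra.IsCocomm R H] {R' : Type w} [CommRing R'] [Algebra R R']

/-- `𝒟 = Hom_R(H, R')` with convolution, a commutative ring (the base change to `R'` of the
Cartier dual algebra `H^∨` of `H`, whose multiplication is the dual of the comultiplication;
Görtz–Wedhorn II, §(27.13), PDF p. 833, and Def. 27.82, PDF p. 834). -/
local notation "𝒟" => WithConv (H →ₗ[R] R')

/-- `ℰ = Hom_R(H, R' ⊗_R H)` with convolution, a commutative ring (`≅ 𝒟 ⊗_R H`, the coordinate
ring of the base change of `Spec H` to `𝒟`). -/
local notation "ℰ" => WithConv (H →ₗ[R] R' ⊗[R] H)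

/-- The inclusion `R' → R' ⊗ H` as an `R`-algebra homomorphism. -/
local notation "incL" => (Algebra.TensorProduct.includeLeft : R' →ₐ[R] R' ⊗[R] H)

/-- The inclusion `H → R' ⊗ H` (the "universal point") as an `R`-algebra homomorphism. -/
local notation "incR" => (Algebra.TensorProduct.includeRight : H →ₐ[R] R' ⊗[R] H)

/-- `ℰ = Hom_R(H, R' ⊗ H)` is an algebra over `𝒟 = Hom_R(H, R')` via post-composition with
`R' → R' ⊗ H` (a reducible `def`, used as a local instance only). [folklore] -/
abbrev instAlgebra : Algebra 𝒟 ℰ := (postComp (H := H) incL).toAlgebra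

attribute [local instance] instAlgebra

/-- Unfolding the `𝒟`-algebra structure of `ℰ`. [folklore] -/
theorem algebraMap_eq (φ : 𝒟) : algebraMap 𝒟 ℰ φ = postComp incL φ := rfl

/-- The `𝒟`-action on `ℰ` in Sweedler notation: `(φ • F)(c) = ∑ φ(c₁) • F(c₂)`. [folklore] -/
theorem smul_apply {ι : Type*} {c : H} (𝓡 : Coalgebra.Repr R c ι) (φ : 𝒟) (F : ℰ) :
    (φ • F) c = ∑ i ∈ 𝓡.index, φ (𝓡.left i) • F (𝓡.right i) := by
  rw [Algebra.smul_def, algebraMap_eq, 𝓡.convMul_apply]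
  refine Finset.sum_congr rfl fun i _ ↦ ?_
  rw [postComp_apply, Algebra.smul_def]
  rfl

variable {ι : Type*} [Fintype ι] (b : Module.Basis ι R H)

/-- The `i`-th coordinate `R' ⊗ H → R'` with respect to the `R'`-basis `1 ⊗ bᵢ`, as an
`R`-linear map. [folklore] -/
def coordR (i : ι) : R' ⊗[R] H →ₗ[R] R' :=
  ((Algebra.TensorProduct.basis R' b).coord i).restrictScalars R

omit [IsCocomm R H] [Fintype ι] in
/-- `coordR` is `R'`-linear. [folklore] -/
theorem coordR_smul (i : ι) (r : R') (v : R' ⊗[R] H) : coordR b i (r • v) = r * coordR b i v :=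
  ((Algebra.TensorProduct.basis R' b).coord i).map_smul r v

omit [IsCocomm R H] [Fintype ι] in
/-- `coordR i (1 ⊗ b k) = δ_{ik}`. [folklore] -/
theorem coordR_one_tmul [DecidableEq ι] (i k : ι) :
    coordR (R' := R') b i (1 ⊗ₜ b k) = if k = i then 1 else 0 := by
  rw [coordR, LinearMap.restrictScalars_apply, ← Algebra.TensorProduct.basis_apply,
    Module.Basis.coord_apply, Module.Basis.repr_self, Finsupp.single_apply]

omit [IsCocomm R H] in
/-- `∑ᵢ coordR i v • (1 ⊗ bᵢ) = v`. [folklore] -/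
theorem sum_coordR_smul (v : R' ⊗[R] H) : ∑ i, coordR b i v • ((1 : R') ⊗ₜ[R] b i) = v := by
  conv_rhs => rw [← (Algebra.TensorProduct.basis R' b).sum_repr v]
  refine Finset.sum_congr rfl fun i _ ↦ ?_
  rw [Algebra.TensorProduct.basis_apply]
  rfl

/-- The coordinates of `F ∈ E` over `D`: `F ↦ (coordᵢ ∘ F)ᵢ`. [folklore] -/
def coordE (F : ℰ) (i : ι) : 𝒟 := toConv (coordR b i ∘ₗ F.ofConv)

/-- The inverse of `coordE`: `(φᵢ)ᵢ ↦ (c ↦ ∑ᵢ φᵢ(c) • (1 ⊗ bᵢ))`. [folklore] -/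
def ofCoordE (g : ι → 𝒟) : ℰ :=
  toConv (∑ i, (LinearMap.toSpanSingleton R' (R' ⊗[R] H) ((1 : R') ⊗ₜ[R] b i)).restrictScalars R
    ∘ₗ (g i).ofConv)

omit [IsCocomm R H] [Fintype ι] in
/-- `coordE F i c = coordᵢ (F c)`. [folklore] -/
@[simp]
theorem coordE_apply (F : ℰ) (i : ι) (c : H) : coordE b F i c = coordR b i (F c) :=
  rfl

omit [IsCocomm R H] in
/-- `ofCoordE g c = ∑ᵢ gᵢ(c) • (1 ⊗ bᵢ)`. [folklore] -/
@[simp]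
theorem ofCoordE_apply (g : ι → 𝒟) (c : H) :
    ofCoordE b g c = ∑ i, g i c • ((1 : R') ⊗ₜ[R] b i) := by
  simp [ofCoordE]

/-- **`E` is free of rank `card ι` over `D`.** The coordinate isomorphism `E ≃ (ι → D)` of
`D`-modules (`E ≅ D ⊗_R H` and `H` is free on `ι`). [folklore] -/
def coordEquiv : ℰ ≃ₗ[𝒟] (ι → 𝒟) where
  toFun := coordE b
  invFun := ofCoordE b
  map_add' F G := by
    ext i c
    simp
  map_smul' φ F := by
    ext i c
    change coordR b i ((φ • F) c) = (φ * coordE b F i) c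
    rw [smul_apply (ℛ R c), (ℛ R c).convMul_apply, map_sum]
    refine Finset.sum_congr rfl fun k _ ↦ ?_
    rw [coordR_smul]
    rfl
  left_inv F := by
    ext c
    simp only [ofCoordE_apply, coordE_apply]
    exact sum_coordR_smul b (F c)
  right_inv g := by
    classical
    ext i c
    simp only [coordE_apply, ofCoordE_apply, map_sum, coordR_smul,
      coordR_one_tmul, mul_ite, mul_one, mul_zero, Finset.sum_ite_eq', Finset.mem_univ, if_true]

/-- The `D`-basis of `E` corresponding to `1 ⊗ bᵢ`. [folklore] -/
def basisE : Module.Basis ι (𝒟) (ℰ) := .ofEquivFun (coordEquiv b)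

/-! ### The unit `I` and the translations -/

variable (R H R') in
/-- The universal point `I = (h ↦ 1 ⊗ h) ∈ ℰ`. [folklore] -/
def unitI : ℰ := toConv (incR).toLinearMap

/-- `I` is a unit of `ℰ`, with inverse `h ↦ 1 ⊗ S(h)` (Mathlib `LinearMap.id_mul_antipode`). [folklore] -/
theorem isUnit_unitI : IsUnit (unitI R H R') := by
  refine IsUnit.of_mul_eq_one (toConv ((incR).toLinearMap ∘ₗ antipode R)) ?_
  change postComp incR (toConv .id) * postComp incR (toConv (antipode R (A := H))) = 1
  rw [← map_mul, LinearMap.id_mul_antipode, map_one]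

/-- A point `x : H → R'` pushed into `R' ⊗ H`, as an element of the convolution monoid
`Hom_{R-alg}(H, R' ⊗ H)`. [folklore] -/
def hat (x : WithConv (H →ₐ[R] R')) : WithConv (H →ₐ[R] R' ⊗[R] H) :=
  toConv ((incL).comp x.ofConv)

omit [IsCocomm R H] [Fintype ι] in
/-- `hat` is multiplicative (Mathlib `AlgHom.comp_convMul_distrib`). [folklore] -/
theorem hat_mul (x y : WithConv (H →ₐ[R] R')) : hat (x * y) = hat x * hat y :=
  congrArg toConv (AlgHom.comp_convMul_distrib incL x y)

omit [IsCocomm R H] [Fintype ι] in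
/-- `hat 1 = 1`. [folklore] -/
theorem hat_one : hat (1 : WithConv (H →ₐ[R] R')) = 1 := by
  apply WithConv.ofConv_injective
  ext c
  simp [hat, Algebra.TensorProduct.algebraMap_apply]

/-- Left translation by `x` on the universal point: `τ_x = hat x * incR : H → R' ⊗ H`,
`h ↦ ∑ x(h₁) ⊗ h₂`, an `R`-algebra homomorphism. [folklore] -/
def transHom (x : WithConv (H →ₐ[R] R')) : H →ₐ[R] R' ⊗[R] H :=
  (hat x * toConv (incR)).ofConv

/-- Left translation by `x` as an `R'`-algebra endomorphism `σ_x` of `R' ⊗ H`,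
`r ⊗ h ↦ ∑ r x(h₁) ⊗ h₂` (Görtz–Wedhorn II, proof of Prop. 27.86). [folklore] -/
def transAlgHom (x : WithConv (H →ₐ[R] R')) : R' ⊗[R] H →ₐ[R'] R' ⊗[R] H :=
  Algebra.TensorProduct.lift (Algebra.ofId R' _) (transHom x) fun _ _ ↦ .all _ _

omit [IsCocomm R H] [Fintype ι] in
/-- `σ_x` restricted to `H` is `τ_x`. [folklore] -/
theorem transAlgHom_comp_incR (x : WithConv (H →ₐ[R] R')) :
    ((transAlgHom x).restrictScalars R).comp incR = transHom x :=
  Algebra.TensorProduct.lift_comp_includeRight _ _ _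

omit [IsCocomm R H] [Fintype ι] in
/-- `σ_x` restricted to `R'` is the inclusion. [folklore] -/
theorem transAlgHom_comp_incL (x : WithConv (H →ₐ[R] R')) :
    ((transAlgHom x).restrictScalars R).comp incL = incL := by
  ext r
  change transAlgHom x (algebraMap R' (R' ⊗[R] H) r) = algebraMap R' (R' ⊗[R] H) r
  exact (transAlgHom x).commutes r

omit [IsCocomm R H] [Fintype ι] in
/-- `σ_x ∘ hat y = hat y` (`σ_x` is `R'`-linear). [folklore] -/
theorem transAlgHom_comp_hat (x y : WithConv (H →ₐ[R] R')) :
    ((transAlgHom x).restrictScalars R).comp (hat y).ofConv = (hat y).ofConv := by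
  rw [hat, ofConv_toConv, ← AlgHom.comp_assoc, transAlgHom_comp_incL]

omit [IsCocomm R H] [Fintype ι] in
/-- **Translations compose**: `σ_x ∘ σ_y = σ_{y x}`. [folklore] -/
theorem transAlgHom_comp (x y : WithConv (H →ₐ[R] R')) :
    (transAlgHom x).comp (transAlgHom y) = transAlgHom (y * x) := by
  refine Algebra.TensorProduct.ext (Subsingleton.elim _ _) ?_
  change ((transAlgHom x).restrictScalars R).comp
      (((transAlgHom y).restrictScalars R).comp incR) = _
  rw [transAlgHom_comp_incR, transAlgHom_comp_incR, transHom, transHom,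
    AlgHom.comp_convMul_distrib, ofConv_toConv, transAlgHom_comp_hat, transAlgHom_comp_incR,
    transHom, toConv_ofConv, toConv_ofConv, ← mul_assoc, hat_mul]

omit [IsCocomm R H] [Fintype ι] in
/-- `σ_1 = id`. [folklore] -/
theorem transAlgHom_one : transAlgHom (1 : WithConv (H →ₐ[R] R')) = AlgHom.id R' _ := by
  refine Algebra.TensorProduct.ext (Subsingleton.elim _ _) ?_
  change ((transAlgHom 1).restrictScalars R).comp incR = _
  rw [transAlgHom_comp_incR, transHom, hat_one, one_mul, ofConv_toConv]
  rfl

/-- Left translation by `x` as an `R'`-algebra **automorphism** of `R' ⊗ H`, with inverse the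
translation by `x⁻¹`. [folklore] -/
def transAlgEquiv (x : WithConv (H →ₐ[R] R')) : R' ⊗[R] H ≃ₐ[R'] R' ⊗[R] H :=
  AlgEquiv.ofAlgHom (transAlgHom x) (transAlgHom (convInv x))
    (by rw [transAlgHom_comp, convInv_mul, transAlgHom_one])
    (by rw [transAlgHom_comp, mul_convInv, transAlgHom_one])

/-- Post-composition with `σ_x`, a ring automorphism of `E`. [folklore] -/
def postTransRingEquiv (x : WithConv (H →ₐ[R] R')) : ℰ ≃+* ℰ :=
  RingEquiv.ofRingHom (postComp ((transAlgHom x).restrictScalars R))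
    (postComp ((transAlgHom (convInv x)).restrictScalars R))
    (by
      ext F c
      change transAlgHom x (transAlgHom (convInv x) (F c)) = F c
      rw [← AlgHom.comp_apply, transAlgHom_comp, convInv_mul, transAlgHom_one, AlgHom.id_apply])
    (by
      ext F c
      change transAlgHom (convInv x) (transAlgHom x (F c)) = F c
      rw [← AlgHom.comp_apply, transAlgHom_comp, mul_convInv, transAlgHom_one, AlgHom.id_apply])

/-- **Post-composition with `σ_x` is a `D`-algebra automorphism `T_x` of `E`.** [folklore] -/
def postTrans (x : WithConv (H →ₐ[R] R')) : ℰ ≃ₐ[𝒟] ℰ :=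
  AlgEquiv.ofRingEquiv (f := postTransRingEquiv x) fun φ ↦ by
    change postComp ((transAlgHom x).restrictScalars R) (postComp incL φ) =
      postComp incL φ
    rw [← postComp_comp, transAlgHom_comp_incL]

/-- **The key identity** `T_x I = ξ • I`, where `ξ ∈ D` is the linear map underlying `x`:
translating the universal point by `x` multiplies it by `x` (Görtz–Wedhorn II, proof of
Prop. 27.86). [folklore] -/
theorem postTrans_unitI (x : WithConv (H →ₐ[R] R')) :
    postTrans x (unitI R H R') =
      algebraMap (𝒟) _ (toConv x.ofConv.toLinearMap) * unitI R H R' := by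
  change postComp ((transAlgHom x).restrictScalars R) (toConv (incR).toLinearMap) = _
  rw [postComp_toConv_toLinearMap, transAlgHom_comp_incR, transHom,
    ← toConv_ofConv (hat x * toConv (incR)), AlgHom.toLinearMap_convMul]
  rfl

/-! ### Deligne's theorem -/

/-- **Deligne's theorem** (Görtz–Wedhorn II, Prop. 27.86; Tate–Oort 1970, §1). Let `H` be a
commutative cocommutative Hopf algebra over `R`, finite free of rank `m` as an `R`-module, and
let `R'` be a commutative `R`-algebra. Then every `R'`-valued point `x ∈ Hom_{R-alg}(H, R')` of
the finite free commutative group scheme `Spec H` satisfies `x ^ m = 1` in the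
convolution monoid. Proof: with `N = N_{E/D}`, `N(I) = N(T_x I) = N(ξ • I) = ξ ^ m N(I)` and
`N(I)` is a unit. [cite: GortzWedhorn2023, Prop. 27.86] -/
theorem convPow_finrank_eq_one [Module.Free R H] [Module.Finite R H]
    (x : WithConv (H →ₐ[R] R')) : x ^ Module.finrank R H = 1 := by
  cases subsingleton_or_nontrivial R with
  | inl hR =>
    have : Subsingleton R' := subsingleton_of_zero_eq_one <| by
      rw [← (algebraMap R R').map_one, Subsingleton.elim (1 : R) 0, map_zero]
    exact WithConv.ext (AlgHom.ext fun _ ↦ Subsingleton.elim _ _)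
  | inr hR => ?_
  let b := Module.Free.chooseBasis R H
  set ξ : 𝒟 := toConv x.ofConv.toLinearMap with hξ
  -- norms over `D`
  have h1 : Algebra.norm (𝒟) (postTrans x (unitI R H R')) =
      Algebra.norm (𝒟) (unitI R H R') :=
    Algebra.norm_eq_of_algEquiv _ _
  rw [postTrans_unitI, map_mul, Algebra.norm_algebraMap_of_basis (basisE b),
    ← Module.finrank_eq_card_chooseBasisIndex] at h1
  have hξm : ξ ^ Module.finrank R H = 1 :=
    ((isUnit_unitI (R := R) (H := H) (R' := R')).map _).mul_left_injective
      (h1.trans (one_mul _).symm)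
  -- back to algebra homomorphisms
  apply WithConv.ofConv_injective
  apply AlgHom.toLinearMap_injective
  apply WithConv.toConv_injective
  rw [AlgHom.toLinearMap_convPow, AlgHom.toLinearMap_convOne]
  exact hξm

end Algebras

end Deligne

namespace FiniteFlatGroupScheme

/-- **A finite free commutative group scheme is annihilated by its order**
(Deligne's theorem; Görtz–Wedhorn II, Prop. 27.86, stated there for finite *locally* free `G / S`
of constant rank — the free case formalised here is its restriction to an affine base trivialising
`𝒪_G`; Tate–Oort 1970, §1), in Hopf-algebra form: if `H` is a commutative cocommutative Hopf
`R`-algebra which is finite free of rank `m` over `R`, then for every commutative `R`-algebra `R'`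
every point `x ∈ Hom_{R-alg}(H, R')` has `x ^ m = 1` for the convolution product. The algebra `R'`
ranges over `Type u`, the universe of `R`; for `R'` in another universe use
`Literature.NumberTheory.DiophantineGeometry.Deligne.convPow_finrank_eq_one`, which is universe-polymorphic in `R'`. [cite: GortzWedhorn2023, Prop. 27.86] -/
def killedByOrder (R : Type u) [CommRing R] (H : Type v) [CommRing H] [HopfAlgebra R H] : Prop :=
  ∀ [Coalgebra.IsCocomm R H] [Module.Free R H] [Module.Finite R H]
    (R' : Type u) (_ : CommRing R') (_ : Algebra R R') (x : WithConv (H →ₐ[R] R')),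
    x ^ Module.finrank R H = 1

/-- Deligne's theorem holds (`Literature.NumberTheory.DiophantineGeometry.Deligne.convPow_finrank_eq_one`). [cite: GortzWedhorn2023, Prop. 27.86] -/
theorem killedByOrder_holds (R : Type u) [CommRing R] (H : Type v) [CommRing H]
    [HopfAlgebra R H] : killedByOrder R H :=
  fun _ _ _ x ↦ Deligne.convPow_finrank_eq_one x

end FiniteFlatGroupScheme

end Literature.NumberTheory.DiophantineGeometry
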